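import Literature.Computability.MetaComplexity.DepthFregeSequents
import HarnessLib

/-!
# Flat relations, the Paris–Wilkie–Woods amplification and the halving formulas

Part 2 of the discharge of `pudlak_ramseyFourPow_depthFrege_upperBound`: flat relations
(`Rel`, `compose`, `TotR`, `DisjR`) and the transfer of totality/disjointness through
composition; the amplification `ampl_spec` of a disjoint total relation `[2h] → [h]` to
`[h²] → [h]` (Krajíček, *Proof Complexity* 2019, Lemma 11.4.1, after Paris–Wilkie–Woods 1988);
the definitions and syntactic bounds of the Maciel–Pitassi–Woods halving argument
(`relB`, `good`, `low`, `goodIntro`, `goodElim_tot/disj`) and its parameter bundle `HB`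
(Krajíček 2019, proof of Thm. 11.4.7). All results are proved; no named facts.
-/

namespace Literature.Computability.MetaComplexity

open Complexity Complexity.PropForm

namespace DepthFrege

open TextbookFrege (disjList disjList_nil disjList_cons conjList conjList_nil conjList_cons)

/-! ### L5. Flat relations: composition, disjointness and totality transfer -/

/-- A flat relation presentation: `K x y` lists the witness formulas for "pigeon `x` goes to
hole `y`". [folklore] -/
abbrev Rel := ℕ → ℕ → List (PropForm ℕ)

/-- Pre-composition of a flat relation `Old` with an atomic relation `Atom` (pigeon `x` to
intermediate `v ∈ V`), with the hole translation `τ`. [folklore] -/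
def compose (Atom Old : Rel) (τ : ℕ → ℕ) (V : List ℕ) : Rel :=
  fun x y => V.flatMap fun v => (Atom x v).flatMap fun α => (Old v (τ y)).map fun κ => conj α κ

/-- Auxiliary lemma `mem_compose` (bounded-depth Frege toolkit / Pudlák–Krajíček construction, see the section header). [folklore] -/
theorem mem_compose {Atom Old : Rel} {τ : ℕ → ℕ} {V : List ℕ} {x y : ℕ} {χ : PropForm ℕ} :
    χ ∈ compose Atom Old τ V x y ↔
      ∃ v ∈ V, ∃ α ∈ Atom x v, ∃ κ ∈ Old v (τ y), χ = conj α κ := by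
  simp only [compose, List.mem_flatMap, List.mem_map]
  constructor
  · rintro ⟨v, hv, α, hα, κ, hκ, rfl⟩; exact ⟨v, hv, α, hα, κ, hκ, rfl⟩
  · rintro ⟨v, hv, α, hα, κ, hκ, rfl⟩; exact ⟨v, hv, α, hα, κ, hκ, rfl⟩

section L5

variable {Q : SPrm} {Γ : List (PropForm ℕ)} {t : ℕ}

/-- Disjointness of a flat relation in context `Γ`: distinct pigeons `x, x' < m` never share a
hole `y < n`. [folklore] -/
def DisjR (Q : SPrm) (t : ℕ) (Γ : List (PropForm ℕ)) (m n : ℕ) (K : Rel) : Prop :=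
  ∀ x < m, ∀ x' < m, x ≠ x' → ∀ y < n, ∀ κ ∈ K x y, ∀ κ' ∈ K x' y,
    Sq Q t (neg κ :: neg κ' :: Γ)

/-- Totality of a flat relation in context `Γ`: every pigeon `x < m` has a hole `y < n`. [folklore] -/
def TotR (Q : SPrm) (t : ℕ) (Γ : List (PropForm ℕ)) (m n : ℕ) (K : Rel) : Prop :=
  ∀ x < m, Sq Q t (Γ ++ (List.range n).flatMap (K x))

/-- Auxiliary lemma `DisjR.mono` (bounded-depth Frege toolkit / Pudlák–Krajíček construction, see the section header). [folklore] -/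
theorem DisjR.mono {m n : ℕ} {K : Rel} {t' : ℕ} (h : DisjR Q t Γ m n K) (ht : t ≤ t') :
    DisjR Q t' Γ m n K :=
  fun x hx x' hx' hne y hy κ hκ κ' hκ' => (h x hx x' hx' hne y hy κ hκ κ' hκ').mono ht

/-- Auxiliary lemma `TotR.mono` (bounded-depth Frege toolkit / Pudlák–Krajíček construction, see the section header). [folklore] -/
theorem TotR.mono {m n : ℕ} {K : Rel} {t' : ℕ} (h : TotR Q t Γ m n K) (ht : t ≤ t') :
    TotR Q t' Γ m n K :=
  fun x hx => (h x hx).mono ht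

/-- Swapping the two head members. [folklore] -/
theorem Sq.swap {A B : PropForm ℕ} {L : List (PropForm ℕ)} (h : Sq Q t (A :: B :: L)) :
    Sq Q (t + 1) (B :: A :: L) :=
  h.weaken₂ _ (by intro C hC; simp only [List.mem_cons] at hC ⊢; tauto)
    (by intro C hC; simp only [List.mem_cons] at hC ⊢; tauto) (by have := h.length_le; simp at this ⊢; omega)

/-- Disjointness transfers through composition. [folklore] -/
theorem disjR_compose {Atom Old : Rel} {τ : ℕ → ℕ} {V : List ℕ} {m n : ℕ}
    (hA : ∀ x < m, ∀ x' < m, x ≠ x' → ∀ v ∈ V, ∀ α ∈ Atom x v, ∀ α' ∈ Atom x' v,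
      Sq Q t (neg α :: neg α' :: Γ))
    (hO : ∀ v ∈ V, ∀ v' ∈ V, v ≠ v' → ∀ y < n, ∀ κ ∈ Old v (τ y), ∀ κ' ∈ Old v' (τ y),
      Sq Q t (neg κ :: neg κ' :: Γ))
    (hB : ∀ x < m, ∀ y < n, ∀ χ ∈ compose Atom Old τ V x y, Base Q (neg χ))
    (hW : Γ.length + 4 ≤ Q.W) :
    DisjR Q (t + 6) Γ m n (compose Atom Old τ V) := by
  intro x hx x' hx' hne y hy χ hχ χ' hχ'
  have hbχ := hB x hx y hy χ hχ
  have hbχ' := hB x' hx' y hy χ' hχ'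
  obtain ⟨v, hv, α, hα, κ, hκ, rfl⟩ := mem_compose.1 hχ
  obtain ⟨v', hv', α', hα', κ', hκ', rfl⟩ := mem_compose.1 hχ'
  by_cases hvv : v = v'
  · subst hvv
    have h1 := hA x hx x' hx' hne v hv α hα α' hα'
    have h2 := Sq.negConjOfLeft (B := κ) h1 hbχ (by simp; omega)
    have h3 := Sq.negConjOfLeft (B := κ') h2.swap hbχ' (by simp; omega)
    exact h3.swap.mono (by omega)
  · have h1 := hO v hv v' hv' hvv y hy κ hκ κ' hκ'
    have h2 := Sq.negConjOfRight (A := α) h1 hbχ (by simp; omega)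
    have h3 := Sq.negConjOfRight (A := α') h2.swap hbχ' (by simp; omega)
    exact h3.swap.mono (by omega)

/-- Totality transfers through composition (for one pigeon `x`), given totality of the atoms
onto `Vx ⊆ V` and totality of the old relation into the `τ`-image for every `v ∈ Vx`. [folklore] -/
theorem tot_compose {Atom Old : Rel} {τ : ℕ → ℕ} {V Vx : List ℕ} {x n Wv : ℕ}
    (hVx : ∀ v ∈ Vx, v ∈ V)
    (hA : Sq Q t (Γ ++ Vx.flatMap (Atom x)))
    (hO : ∀ v ∈ Vx, Sq Q t (Γ ++ (List.range n).flatMap (fun y => Old v (τ y))))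
    (hWv : ∀ v ∈ Vx, ((List.range n).flatMap (fun y => Old v (τ y))).length ≤ Wv)
    (hB : ∀ y < n, ∀ χ ∈ compose Atom Old τ V x y, Base Q χ)
    (hBa : ∀ v ∈ Vx, ∀ α ∈ Atom x v, Base Q (neg α))
    (hBo : ∀ v ∈ Vx, ∀ y < n, ∀ κ ∈ Old v (τ y), Base Q (neg κ))
    (hW : (Vx.flatMap (Atom x)).length + Wv + Γ.length +
      ((List.range n).flatMap (compose Atom Old τ V x)).length + 3 ≤ Q.W) :
    Sq Q (t + 1 + (Vx.flatMap (Atom x)).length * (t + 6 * Wv + 3))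
      (Γ ++ (List.range n).flatMap (compose Atom Old τ V x)) := by
  set Tg := (List.range n).flatMap (compose Atom Old τ V x) with hTg
  set Δ := Vx.flatMap (Atom x) with hΔ
  have hΓ : ∀ C ∈ Γ, Base Q C := fun C hC => hA.base C (by simp [hC])
  have hTgB : ∀ C ∈ Tg, Base Q C := by
    intro C hC
    simp only [hTg, List.mem_flatMap, List.mem_range] at hC
    obtain ⟨y, hy, hC⟩ := hC
    exact hB y hy C hC
  -- targets: membership
  have hmemTg : ∀ v ∈ Vx, ∀ α ∈ Atom x v, ∀ y < n, ∀ κ ∈ Old v (τ y), conj α κ ∈ Tg := by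
    intro v hv α hα y hy κ hκ
    simp only [hTg, List.mem_flatMap, List.mem_range]
    exact ⟨y, hy, mem_compose.2 ⟨v, hVx v hv, α, hα, κ, hκ, rfl⟩⟩
  -- Step 1: atoms in front
  have h1 : Sq Q (t + 1) (Δ ++ (Γ ++ Tg)) :=
    hA.weaken₂ _ (by intro C hC; simp only [List.mem_append] at hC ⊢; tauto)
      (by
        intro C hC; simp only [List.mem_append] at hC ⊢
        rcases hC with hC | hC | hC
        · exact Or.inl (Or.inr hC)
        · exact Or.inl (Or.inl hC)
        · exact Or.inr (hTgB C hC))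
      (by simp [hΔ, hTg] at hW ⊢; omega)
  refine Sq.multiCut Δ h1 ?_
  intro α hαΔ
  simp only [hΔ, List.mem_flatMap] at hαΔ
  obtain ⟨v, hv, hα⟩ := hαΔ
  set Δv := (List.range n).flatMap (fun y => Old v (τ y)) with hΔv
  have hΔvB : ∀ C ∈ Δv, Base Q (neg C) := by
    intro C hC
    simp only [hΔv, List.mem_flatMap, List.mem_range] at hC
    obtain ⟨y, hy, hC⟩ := hC
    exact hBo v hv y hy C hC
  have h2 : Sq Q (t + 1) (Δv ++ (neg α :: (Γ ++ Tg))) :=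
    (hO v hv).weaken₂ _ (by intro C hC; simp only [List.mem_append, List.mem_cons] at hC ⊢; tauto)
      (by
        intro C hC; simp only [List.mem_append, List.mem_cons] at hC ⊢
        rcases hC with hC | rfl | hC | hC
        · exact Or.inl (Or.inr hC)
        · exact Or.inr (hBa v hv _ hα)
        · exact Or.inl (Or.inl hC)
        · exact Or.inr (hTgB C hC))
      (by have := hWv v hv; simp [hΔv, hTg] at hW this ⊢; omega)
  have h3 := Sq.multiCut Δv h2 (t' := 4) (by
    intro κ hκΔ
    have hκΔ' := hκΔ
    simp only [hΔv, List.mem_flatMap, List.mem_range] at hκΔ'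
    obtain ⟨y, hy, hκ⟩ := hκΔ'
    refine Sq.conjParts (A := α) (B := κ) ?_ ?_ (by simp) (by simp) ?_
    · intro C hC; simp only [List.mem_cons, List.mem_append] at hC
      rcases hC with rfl | rfl | hC | hC
      · exact hΔvB _ hκΔ
      · exact hBa v hv _ hα
      · exact hΓ C hC
      · exact hTgB C hC
    · simp [hTg] at hW ⊢; omega
    · simp [hmemTg v hv α hα y hy κ hκ])
  refine h3.mono ?_
  have := hWv v hv
  rw [← hΔv] at this
  have e1 : Δv.length * (4 + 2) ≤ Wv * 6 := Nat.mul_le_mul this (le_refl _)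
  omega

end L5


/-! ### L6. Depth/size invariant of chains; amplification `[2h] → [h]` to `[h²] → [h]` -/

/-- Chain invariant: as a conjunct the formula has depth at most `d`, and size at most `s`. [cite: Krajicek2019, Lemma 11.4.1] -/
def Small (d s : ℕ) (φ : PropForm ℕ) : Prop := altDepthAux 2 φ ≤ d ∧ φ.size ≤ s

/-- Auxiliary lemma `Small.mono` (bounded-depth Frege toolkit / Pudlák–Krajíček construction, see the section header). [cite: Krajicek2019, Lemma 11.4.1] -/
theorem Small.mono {d s s' : ℕ} {φ : PropForm ℕ} (h : Small d s φ) (hs : s ≤ s') : Small d s' φ :=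
  ⟨h.1, h.2.trans hs⟩

/-- Auxiliary lemma `Small.of_altDepth` (bounded-depth Frege toolkit / Pudlák–Krajíček construction, see the section header). [cite: Krajicek2019, Lemma 11.4.1] -/
theorem Small.of_altDepth {d s : ℕ} {φ : PropForm ℕ} (hd : φ.altDepth ≤ d) (hs : φ.size ≤ s) :
    Small d s φ :=
  ⟨(altDepthAux_le_altDepth 2 φ).trans hd, hs⟩

/-- Auxiliary lemma `Small.conj` (bounded-depth Frege toolkit / Pudlák–Krajíček construction, see the section header). [cite: Krajicek2019, Lemma 11.4.1] -/
theorem Small.conj {d s s' : ℕ} {α κ : PropForm ℕ} (ha : Small d s α) (hk : Small d s' κ) :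
    Small d (s + s' + 1) (conj α κ) := by
  refine ⟨?_, by simp [size]; have := ha.2; have := hk.2; omega⟩
  have h1 := ha.1; have h2 := hk.1
  simp only [altDepthAux, if_true]
  omega

/-- Auxiliary lemma `Small.altDepth_le` (bounded-depth Frege toolkit / Pudlák–Krajíček construction, see the section header). [cite: Krajicek2019, Lemma 11.4.1] -/
theorem Small.altDepth_le {d s : ℕ} {φ : PropForm ℕ} (h : Small d s φ) : φ.altDepth ≤ d + 1 :=
  (altDepthAux_le_succ 0 2 φ).trans (by have := h.1; omega)

/-- Auxiliary lemma `Small.base` (bounded-depth Frege toolkit / Pudlák–Krajíček construction, see the section header). [cite: Krajicek2019, Lemma 11.4.1] -/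
theorem Small.base {Q : SPrm} {d s : ℕ} {φ : PropForm ℕ} (h : Small d s φ) (hD : d + 3 ≤ Q.D)
    (hM : s + 2 ≤ Q.M) : Base Q φ ∧ Base Q (neg φ) ∧ Base Q (neg (neg φ)) := by
  have h0 := h.altDepth_le
  have h1 : (neg φ).altDepth ≤ d + 2 := by
    have := altDepthAux_le_succ 1 2 φ
    have h' := h.1
    simp only [altDepth, altDepthAux, show (0:ℕ) ≠ 1 from by decide, if_false]; omega
  have h2 : (neg (neg φ)).altDepth ≤ d + 3 := by
    have := altDepthAux_le_succ 1 2 φ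
    have h' := h.1
    simp only [altDepth, altDepthAux, show (0:ℕ) ≠ 1 from by decide, if_false, if_true]; omega
  exact ⟨⟨by omega, by have := h.2; omega⟩, ⟨by omega, by have := h.2; simp [size]; omega⟩,
    ⟨by omega, by have := h.2; simp [size]; omega⟩⟩

/-- Auxiliary lemma `small_compose` (bounded-depth Frege toolkit / Pudlák–Krajíček construction, see the section header). [cite: Krajicek2019, Lemma 11.4.1] -/
theorem small_compose {Atom Old : Rel} {τ : ℕ → ℕ} {V : List ℕ} {x y d sa so : ℕ}
    (ha : ∀ v, ∀ α ∈ Atom x v, Small d sa α) (ho : ∀ v y', ∀ κ ∈ Old v y', Small d so κ) :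
    ∀ χ ∈ compose Atom Old τ V x y, Small d (sa + so + 1) χ := by
  intro χ hχ
  obtain ⟨v, _, α, hα, κ, hκ, rfl⟩ := mem_compose.1 hχ
  exact (ha v α hα).conj (ho v _ κ hκ)

/-- Auxiliary lemma `length_flatMap_le` (bounded-depth Frege toolkit / Pudlák–Krajíček construction, see the section header). [cite: Krajicek2019, Lemma 11.4.1] -/
theorem length_flatMap_le {α β : Type*} (l : List α) (f : α → List β) (b : ℕ)
    (hf : ∀ a ∈ l, (f a).length ≤ b) : (l.flatMap f).length ≤ l.length * b := by
  induction l with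
  | nil => simp
  | cons a l ih =>
    simp only [List.flatMap_cons, List.length_append, List.length_cons]
    have := hf a (by simp)
    have := ih (fun a' ha' => hf a' (by simp [ha']))
    rw [Nat.succ_mul]; omega

/-- Auxiliary lemma `length_compose_le` (bounded-depth Frege toolkit / Pudlák–Krajíček construction, see the section header). [cite: Krajicek2019, Lemma 11.4.1] -/
theorem length_compose_le {Atom Old : Rel} {τ : ℕ → ℕ} {V : List ℕ} {x y a o : ℕ}
    (ha : ∀ v, (Atom x v).length ≤ a) (ho : ∀ v, (Old v (τ y)).length ≤ o) :
    (compose Atom Old τ V x y).length ≤ V.length * (a * o) := by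
  unfold compose
  refine length_flatMap_le V _ (a * o) fun v _ => ?_
  refine (length_flatMap_le (Atom x v) _ o fun α _ => by simp [ho v]).trans ?_
  exact Nat.mul_le_mul_right _ (ha v)

section PhaseA

variable {Q : SPrm} {Γ : List (PropForm ℕ)}

/-- Atoms of the amplification step: pigeon `x < 2^(t+2) h` is sent to `(x / 2h)·h + z` for
`z ∈ F(x mod 2h)`. [cite: Krajicek2019, Lemma 11.4.1] -/
def atomA (K : Rel) (h : ℕ) : Rel :=
  fun x v => if v / h = x / (2 * h) then K (x % (2 * h)) (v % h) else []

/-- The amplified relations `F_t : [2^(t+1) h] → [h]` (Krajíček 2019, Lemma 11.4.1). [cite: Krajicek2019, Lemma 11.4.1] -/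
def ampl (K : Rel) (h : ℕ) : ℕ → Rel
  | 0 => K
  | t + 1 => compose (atomA K h) (ampl K h t) id (List.range (2 ^ (t + 1) * h))

/-- Witness bound of `ampl` at level `t`. [cite: Krajicek2019, Lemma 11.4.1] -/
def wA (h cK : ℕ) : ℕ → ℕ
  | 0 => cK
  | t + 1 => (2 ^ (t + 1) * h * cK) * wA h cK t

/-- Auxiliary lemma `length_atomA_le` (bounded-depth Frege toolkit / Pudlák–Krajíček construction, see the section header). [cite: Krajicek2019, Lemma 11.4.1] -/
theorem length_atomA_le {K : Rel} {h cK : ℕ} (hcK : ∀ x y, (K x y).length ≤ cK) (x v : ℕ) :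
    (atomA K h x v).length ≤ cK := by
  unfold atomA; split_ifs <;> simp [hcK]

/-- Auxiliary lemma `length_ampl_le` (bounded-depth Frege toolkit / Pudlák–Krajíček construction, see the section header). [cite: Krajicek2019, Lemma 11.4.1] -/
theorem length_ampl_le {K : Rel} {h cK : ℕ} (hcK : ∀ x y, (K x y).length ≤ cK) :
    ∀ t x y, (ampl K h t x y).length ≤ wA h cK t
  | 0, x, y => by simpa [ampl, wA] using hcK x y
  | t + 1, x, y => by
    simp only [ampl, wA]
    refine (length_compose_le (a := cK) (o := wA h cK t) (length_atomA_le hcK x)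
      (fun v => length_ampl_le hcK t v _)).trans ?_
    simp [List.length_range]; exact le_of_eq (by ring)

/-- Auxiliary lemma `small_atomA` (bounded-depth Frege toolkit / Pudlák–Krajíček construction, see the section header). [cite: Krajicek2019, Lemma 11.4.1] -/
theorem small_atomA {K : Rel} {h d s₀ : ℕ} (hs : ∀ x y, ∀ κ ∈ K x y, Small d s₀ κ) (x v : ℕ) :
    ∀ α ∈ atomA K h x v, Small d s₀ α := by
  unfold atomA; split_ifs
  · exact hs _ _
  · simp

/-- Auxiliary lemma `small_ampl` (bounded-depth Frege toolkit / Pudlák–Krajíček construction, see the section header). [cite: Krajicek2019, Lemma 11.4.1] -/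
theorem small_ampl {K : Rel} {h d s₀ : ℕ} (hs : ∀ x y, ∀ κ ∈ K x y, Small d s₀ κ) :
    ∀ t x y, ∀ χ ∈ ampl K h t x y, Small d ((t + 1) * (s₀ + 1)) χ
  | 0, x, y => fun χ hχ => (hs x y χ hχ).mono (by omega)
  | t + 1, x, y => by
    intro χ hχ
    simp only [ampl] at hχ
    have := small_compose (sa := s₀) (so := (t + 1) * (s₀ + 1)) (small_atomA hs x)
      (fun v y' => small_ampl hs t v y') χ hχ
    exact this.mono (by have := Nat.add_mul (t + 1) 1 (s₀ + 1); omega)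

/-- Tick bound of the totality proofs of `ampl` at level `t`. [cite: Krajicek2019, Lemma 11.4.1] -/
def TA (h cK t₀ : ℕ) : ℕ → ℕ
  | 0 => t₀ + 1
  | t + 1 => TA h cK t₀ t + 2 +
      (2 ^ (t + 1) * h * cK) * (TA h cK t₀ t + 1 + 6 * (h * wA h cK t) + 3)

/-- Auxiliary lemma `TA_ge` (bounded-depth Frege toolkit / Pudlák–Krajíček construction, see the section header). [cite: Krajicek2019, Lemma 11.4.1] -/
theorem TA_ge (h cK t₀ : ℕ) : ∀ t, t₀ + 1 ≤ TA h cK t₀ t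
  | 0 => le_rfl
  | t + 1 => by simp only [TA]; have := TA_ge h cK t₀ t; omega

/-- **Amplification** (Paris–Wilkie–Woods; Krajíček 2019, Lemma 11.4.1): from a total disjoint
flat relation `[2h] → [h]` one gets total disjoint flat relations `[2^(t+1) h] → [h]`. [cite: Krajicek2019, Lemma 11.4.1] -/
theorem ampl_spec {K : Rel} {h cK d s₀ t₀ tmax : ℕ} (hh : 1 ≤ h)
    (hT : TotR Q t₀ Γ (2 * h) h K) (hD : DisjR Q t₀ Γ (2 * h) h K)
    (hs : ∀ x y, ∀ κ ∈ K x y, Small d s₀ κ) (hcK : ∀ x y, (K x y).length ≤ cK)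
    (hQD : d + 3 ≤ Q.D) (hQM : (tmax + 1) * (s₀ + 1) + 2 ≤ Q.M)
    (hW : ∀ t < tmax, 2 ^ (t + 1) * h * cK + h * wA h cK t + Γ.length +
      h * wA h cK (t + 1) + 4 ≤ Q.W) (hW₀ : Γ.length + 4 ≤ Q.W) :
    ∀ t ≤ tmax, TotR Q (TA h cK t₀ t) Γ (2 ^ (t + 1) * h) h (ampl K h t) ∧
      DisjR Q (t₀ + 6 * t) Γ (2 ^ (t + 1) * h) h (ampl K h t)
  | 0, _ => ⟨by simpa [ampl, TA, pow_one] using hT.mono (by omega),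
      by simpa [ampl, pow_one] using hD⟩
  | t + 1, ht => by
    obtain ⟨ihT, ihD⟩ := ampl_spec hh hT hD hs hcK hQD hQM hW hW₀ t (by omega)
    have hbase : ∀ t' ≤ tmax, ∀ x y, ∀ χ ∈ ampl K h t' x y,
        Base Q χ ∧ Base Q (neg χ) ∧ Base Q (neg (neg χ)) := by
      intro t' ht' x y χ hχ
      refine (small_ampl hs t' x y χ hχ).base hQD ?_
      have : (t' + 1) * (s₀ + 1) ≤ (tmax + 1) * (s₀ + 1) := Nat.mul_le_mul_right _ (by omega)
      omega
    have h2h : 0 < 2 * h := by omega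
    constructor
    · -- totality
      intro x hx
      simp only [ampl]
      set q := x / (2 * h) with hq
      set r := x % (2 * h) with hr
      have hr2 : r < 2 * h := Nat.mod_lt _ h2h
      have hq2 : q < 2 ^ (t + 1) := by
        rw [hq, Nat.div_lt_iff_lt_mul h2h]
        calc x < 2 ^ (t + 1 + 1) * h := hx
          _ = 2 ^ (t + 1) * (2 * h) := by ring
      have hV : ∀ z < h, q * h + z ∈ List.range (2 ^ (t + 1) * h) := by
        intro z hz
        rw [List.mem_range]
        calc q * h + z < q * h + h := by omega
          _ = (q + 1) * h := by ring
          _ ≤ 2 ^ (t + 1) * h := Nat.mul_le_mul_right _ hq2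
      -- atoms: weaken totality of `K r`
      have hA : Sq Q (TA h cK t₀ t + 1)
          (Γ ++ (List.range (2 ^ (t + 1) * h)).flatMap (atomA K h x)) := by
        refine ((hT r hr2).mono (by have := TA_ge h cK t₀ t; omega)).weaken₂ _ ?_ ?_ ?_
        · intro C hC
          simp only [List.mem_append, List.mem_flatMap, List.mem_range] at hC ⊢
          rcases hC with hC | ⟨z, hz, hC⟩
          · exact Or.inl hC
          · refine Or.inr ⟨q * h + z, List.mem_range.1 (hV z hz), ?_⟩
            have e1 : (q * h + z) / h = q := by
              rw [Nat.add_comm, Nat.add_mul_div_right _ _ (by omega), Nat.div_eq_of_lt hz]; simp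
            have e2 : (q * h + z) % h = z := by
              rw [Nat.add_comm, Nat.add_mul_mod_self_right, Nat.mod_eq_of_lt hz]
            simp only [atomA, e1, ← hq, if_true, e2, ← hr]
            exact hC
        · intro C hC
          simp only [List.mem_append, List.mem_flatMap, List.mem_range] at hC
          rcases hC with hC | ⟨v, _, hC⟩
          · exact Or.inl (by simp [hC])
          · refine Or.inr ((hs (x % (2 * h)) (v % h) C ?_).base hQD (by nlinarith)).1
            simp only [atomA] at hC; split_ifs at hC with hc
            · exact hC
            · simp at hC
        · have hWt := hW t (by omega)
          have l1 := length_flatMap_le (List.range (2 ^ (t + 1) * h)) (atomA K h x) cK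
            (fun v _ => length_atomA_le hcK x v)
          simp only [List.length_append, List.length_range] at l1 ⊢
          nlinarith [l1]
      have hmain := tot_compose (Q := Q) (Γ := Γ) (Atom := atomA K h) (Old := ampl K h t) (τ := id)
        (V := List.range (2 ^ (t + 1) * h)) (Vx := List.range (2 ^ (t + 1) * h)) (x := x) (n := h)
        (Wv := h * wA h cK t) (t := TA h cK t₀ t + 1) (fun v hv => hv) hA
        (fun v hv => by
          have := (ihT v (List.mem_range.1 hv)).mono (Nat.le_succ _)
          simpa using this)
        (fun v _ => by
          refine (length_flatMap_le _ _ (wA h cK t) fun y _ => ?_).trans (by simp)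
          exact length_ampl_le hcK t v _)
        (fun y _ χ hχ => (hbase (t + 1) ht x y χ (by simpa [ampl] using hχ)).1)
        (fun v _ α hα => ((small_atomA hs x v α hα).base hQD (by nlinarith)).2.1)
        (fun v hv y _ κ hκ => (hbase t (by omega) v y κ (by simpa using hκ)).2.1)
        (by
          have hWt := hW t (by omega)
          have l1 := length_flatMap_le (List.range (2 ^ (t + 1) * h)) (atomA K h x) cK
            (fun v _ => length_atomA_le hcK x v)
          have l2 := length_flatMap_le (List.range h)
            (compose (atomA K h) (ampl K h t) id (List.range (2 ^ (t + 1) * h)) x) (wA h cK (t + 1))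
            (fun y _ => by simpa [ampl] using length_ampl_le hcK (t + 1) x y)
          simp only [List.length_range] at l1 l2 ⊢
          nlinarith [l1, l2])
      refine hmain.mono ?_
      have l1 := length_flatMap_le (List.range (2 ^ (t + 1) * h)) (atomA K h x) cK
        (fun v _ => length_atomA_le hcK x v)
      simp only [List.length_range] at l1
      simp only [TA]
      have : (List.flatMap (atomA K h x) (List.range (2 ^ (t + 1) * h))).length *
          (TA h cK t₀ t + 1 + 6 * (h * wA h cK t) + 3) ≤
          (2 ^ (t + 1) * h * cK) * (TA h cK t₀ t + 1 + 6 * (h * wA h cK t) + 3) :=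
        Nat.mul_le_mul_right _ l1
      omega
    · -- disjointness
      simp only [ampl]
      have hdc := disjR_compose (Q := Q) (Γ := Γ) (t := t₀ + 6 * t) (Atom := atomA K h)
        (Old := ampl K h t) (τ := id) (V := List.range (2 ^ (t + 1) * h))
        (m := 2 ^ (t + 1 + 1) * h) (n := h) ?_ ?_ ?_ hW₀
      · exact hdc.mono (by omega)
      · intro x hx x' hx' hne v _ α hα α' hα'
        simp only [atomA] at hα hα'
        split_ifs at hα hα' with h1 h2
        · have hne' : x % (2 * h) ≠ x' % (2 * h) := by
            intro heq
            apply hne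
            rw [← Nat.div_add_mod x (2 * h), ← Nat.div_add_mod x' (2 * h), heq, ← h1, ← h2]
          exact (hD _ (Nat.mod_lt _ h2h) _ (Nat.mod_lt _ h2h) hne' _ (Nat.mod_lt _ (by omega))
            α hα α' hα').mono (by omega)
        all_goals simp at hα hα'
      · intro v hv v' hv' hne y hy κ hκ κ' hκ'
        exact ihD v (List.mem_range.1 hv) v' (List.mem_range.1 hv') hne y hy κ hκ κ' hκ'
      · intro x _ y _ χ hχ
        exact (hbase (t + 1) ht x y χ (by simpa [ampl] using hχ)).2.1

end PhaseA


/-! ### L7. The Maciel–Pitassi–Woods halving argument: definitions and syntactic bounds -/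

/-- Auxiliary lemma `altDepth_neg_le` (bounded-depth Frege toolkit / Pudlák–Krajíček construction, see the section header). [cite: Krajicek2019, proof of Thm. 11.4.7] -/
theorem altDepth_neg_le (A : PropForm ℕ) : altDepth (neg A) ≤ altDepth A + 1 := by
  have := altDepthAux_le_altDepth 1 A
  simp only [altDepth, altDepthAux, show (0:ℕ) ≠ 1 from by decide, if_false] at this ⊢
  omega

/-- Auxiliary lemma `altDepthAux3_disjList_le` (bounded-depth Frege toolkit / Pudlák–Krajíček construction, see the section header). [cite: Krajicek2019, proof of Thm. 11.4.7] -/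
theorem altDepthAux3_disjList_le {L : List (PropForm ℕ)} {b : ℕ} (h : ∀ A ∈ L, altDepth A ≤ b) :
    altDepthAux 3 (disjList L) ≤ b := by
  induction L with
  | nil => simp [disjList]
  | cons A L ih =>
    rw [disjList_cons]
    simp only [altDepthAux, if_true, Nat.add_zero, max_le_iff]
    exact ⟨(altDepthAux_le_altDepth 3 A).trans (h A (by simp)), ih fun B hB => h B (by simp [hB])⟩

/-- Auxiliary lemma `altDepth_disjList_le` (bounded-depth Frege toolkit / Pudlák–Krajíček construction, see the section header). [cite: Krajicek2019, proof of Thm. 11.4.7] -/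
theorem altDepth_disjList_le {L : List (PropForm ℕ)} {b : ℕ} (h : ∀ A ∈ L, altDepth A ≤ b) :
    altDepth (disjList L) ≤ b + 1 :=
  (altDepthAux_le_succ 0 3 _).trans (by have := altDepthAux3_disjList_le h; omega)

/-- Auxiliary lemma `altDepthAux2_conjList_le` (bounded-depth Frege toolkit / Pudlák–Krajíček construction, see the section header). [cite: Krajicek2019, proof of Thm. 11.4.7] -/
theorem altDepthAux2_conjList_le {L : List (PropForm ℕ)} {b : ℕ} (h : ∀ A ∈ L, altDepth A ≤ b) :
    altDepthAux 2 (conjList L) ≤ b := by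
  induction L with
  | nil => simp [conjList]
  | cons A L ih =>
    rw [conjList_cons]
    simp only [altDepthAux, if_true, Nat.add_zero, max_le_iff]
    exact ⟨(altDepthAux_le_altDepth 2 A).trans (h A (by simp)), ih fun B hB => h B (by simp [hB])⟩

/-- Auxiliary lemma `altDepth_conjList_le` (bounded-depth Frege toolkit / Pudlák–Krajíček construction, see the section header). [cite: Krajicek2019, proof of Thm. 11.4.7] -/
theorem altDepth_conjList_le {L : List (PropForm ℕ)} {b : ℕ} (h : ∀ A ∈ L, altDepth A ≤ b) :
    altDepth (conjList L) ≤ b + 1 :=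
  (altDepthAux_le_succ 0 2 _).trans (by have := altDepthAux2_conjList_le h; omega)

/-- Auxiliary lemma `size_disjList_le` (bounded-depth Frege toolkit / Pudlák–Krajíček construction, see the section header). [cite: Krajicek2019, proof of Thm. 11.4.7] -/
theorem size_disjList_le {L : List (PropForm ℕ)} {b : ℕ} (h : ∀ A ∈ L, size A ≤ b) :
    size (disjList L) ≤ L.length * (b + 1) + 1 := by
  induction L with
  | nil => simp [disjList, size]
  | cons A L ih =>
    rw [disjList_cons]
    simp only [size, List.length_cons]
    have := h A (by simp)
    have := ih fun B hB => h B (by simp [hB])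
    rw [Nat.succ_mul]; omega

/-- Auxiliary lemma `size_conjList_le` (bounded-depth Frege toolkit / Pudlák–Krajíček construction, see the section header). [cite: Krajicek2019, proof of Thm. 11.4.7] -/
theorem size_conjList_le {L : List (PropForm ℕ)} {b : ℕ} (h : ∀ A ∈ L, size A ≤ b) :
    size (conjList L) ≤ L.length * (b + 1) + 1 := by
  induction L with
  | nil => simp [conjList, size]
  | cons A L ih =>
    rw [conjList_cons]
    simp only [size, List.length_cons]
    have := h A (by simp)
    have := ih fun B hB => h B (by simp [hB])
    rw [Nat.succ_mul]; omega

section PhaseBDefs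

/-- Atoms of the "low block" case: pigeon `x` to position `v` of block `i`, via `G x (v mod h)`. [cite: Krajicek2019, proof of Thm. 11.4.7] -/
def atomBi (G : Rel) (h i : ℕ) : Rel :=
  fun x v => if v / h = i then G x (v % h) else []

/-- Atoms of the "every block has an upper element" case: pigeon `x` to any `v` of block
`G x`. [cite: Krajicek2019, proof of Thm. 11.4.7] -/
def atomBs (G : Rel) (h : ℕ) : Rel :=
  fun x v => G x (v / h)

/-- The level-`|w|` relations `R_w : [h²] → [2^(e-|w|)]` of the halving argument
(Krajíček 2019, proof of Thm. 11.4.7): `w` is the list of case letters, most recent first. [cite: Krajicek2019, proof of Thm. 11.4.7] -/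
def relB (G : Rel) (h e : ℕ) : List (Option ℕ) → Rel
  | [] => G
  | some i :: w => compose (atomBi G h i) (relB G h e w) id (List.range (h * h))
  | none :: w => compose (atomBs G h) (relB G h e w) (fun y => y + 2 ^ (e - w.length - 1))
      (List.range (h * h))

/-- Witness bound of `relB` at level `ℓ`. [cite: Krajicek2019, proof of Thm. 11.4.7] -/
def rB (h cG : ℕ) : ℕ → ℕ
  | 0 => cG
  | ℓ + 1 => h * h * (cG * rB h cG ℓ)

/-- The case letters. [cite: Krajicek2019, proof of Thm. 11.4.7] -/
def letters (h : ℕ) : List (Option ℕ) := (List.range h).map some ++ [none]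

/-- All words of length `ℓ`. [cite: Krajicek2019, proof of Thm. 11.4.7] -/
def words (h : ℕ) : ℕ → List (List (Option ℕ))
  | 0 => [[]]
  | ℓ + 1 => (letters h).flatMap fun c => (words h ℓ).map fun w => c :: w

/-- Auxiliary lemma `length_letters` (bounded-depth Frege toolkit / Pudlák–Krajíček construction, see the section header). [cite: Krajicek2019, proof of Thm. 11.4.7] -/
theorem length_letters (h : ℕ) : (letters h).length = h + 1 := by simp [letters]

/-- Auxiliary lemma `length_words` (bounded-depth Frege toolkit / Pudlák–Krajíček construction, see the section header). [cite: Krajicek2019, proof of Thm. 11.4.7] -/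
theorem length_words (h : ℕ) : ∀ ℓ, (words h ℓ).length = (h + 1) ^ ℓ
  | 0 => by simp [words]
  | ℓ + 1 => by
    have ih := length_words h ℓ
    simp only [words]
    have : ∀ c ∈ letters h, ((words h ℓ).map fun w => c :: w).length = (h + 1) ^ ℓ := by
      intro c _; simp [ih]
    have e1 := length_flatMap_le (letters h) (fun c => (words h ℓ).map fun w => c :: w) ((h + 1) ^ ℓ)
      (fun c hc => (this c hc).le)
    -- exact computation by induction on the letter list
    have key : ∀ (cs : List (Option ℕ)),
        (cs.flatMap fun c => (words h ℓ).map fun w => c :: w).length = cs.length * (h + 1) ^ ℓ := by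
      intro cs; induction cs with
      | nil => simp
      | cons c cs ihc => simp [List.flatMap_cons, ihc, ih, Nat.succ_mul, Nat.add_comm]
    rw [key, length_letters, pow_succ, Nat.mul_comm]

/-- Auxiliary lemma `mem_words_length` (bounded-depth Frege toolkit / Pudlák–Krajíček construction, see the section header). [cite: Krajicek2019, proof of Thm. 11.4.7] -/
theorem mem_words_length {h : ℕ} : ∀ {ℓ : ℕ} {w : List (Option ℕ)}, w ∈ words h ℓ → w.length = ℓ
  | 0, w, hw => by simp [words] at hw; simp [hw]
  | ℓ + 1, w, hw => by
    simp only [words, List.mem_flatMap, List.mem_map] at hw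
    obtain ⟨c, _, w', hw', rfl⟩ := hw
    simp [mem_words_length hw']

/-- Auxiliary lemma `cons_mem_words` (bounded-depth Frege toolkit / Pudlák–Krajíček construction, see the section header). [cite: Krajicek2019, proof of Thm. 11.4.7] -/
theorem cons_mem_words {h ℓ : ℕ} {w : List (Option ℕ)} {c : Option ℕ} (hc : c ∈ letters h)
    (hw : w ∈ words h ℓ) : c :: w ∈ words h (ℓ + 1) := by
  simp only [words, List.mem_flatMap, List.mem_map]
  exact ⟨c, hc, w, hw, rfl⟩

/-- Auxiliary lemma `some_mem_letters` (bounded-depth Frege toolkit / Pudlák–Krajíček construction, see the section header). [cite: Krajicek2019, proof of Thm. 11.4.7] -/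
theorem some_mem_letters {h i : ℕ} (hi : i < h) : some i ∈ letters h := by
  simp [letters, hi]

/-- Auxiliary lemma `none_mem_letters` (bounded-depth Frege toolkit / Pudlák–Krajíček construction, see the section header). [cite: Krajicek2019, proof of Thm. 11.4.7] -/
theorem none_mem_letters (h : ℕ) : none ∈ letters h := by
  simp [letters]

/-- Auxiliary lemma `length_relB_le` (bounded-depth Frege toolkit / Pudlák–Krajíček construction, see the section header). [cite: Krajicek2019, proof of Thm. 11.4.7] -/
theorem length_relB_le {G : Rel} {h e cG : ℕ} (hcG : ∀ x y, (G x y).length ≤ cG) :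
    ∀ (w : List (Option ℕ)) x y, (relB G h e w x y).length ≤ rB h cG w.length
  | [], x, y => by simpa [relB, rB] using hcG x y
  | some i :: w, x, y => by
    simp only [relB, rB, List.length_cons]
    refine (length_compose_le (a := cG) (o := rB h cG w.length) (fun v => ?_)
      (fun v => length_relB_le hcG w v _)).trans (by simp [List.length_range])
    unfold atomBi; split_ifs <;> simp [hcG]
  | none :: w, x, y => by
    simp only [relB, rB, List.length_cons]
    refine (length_compose_le (a := cG) (o := rB h cG w.length) (fun v => ?_)
      (fun v => length_relB_le hcG w v _)).trans (by simp [List.length_range])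
    unfold atomBs; exact hcG _ _

/-- Auxiliary lemma `small_relB` (bounded-depth Frege toolkit / Pudlák–Krajíček construction, see the section header). [cite: Krajicek2019, proof of Thm. 11.4.7] -/
theorem small_relB {G : Rel} {h e d s₁ : ℕ} (hs : ∀ x y, ∀ κ ∈ G x y, Small d s₁ κ) :
    ∀ (w : List (Option ℕ)) x y, ∀ χ ∈ relB G h e w x y, Small d ((w.length + 1) * (s₁ + 1)) χ
  | [], x, y => fun χ hχ => (hs x y χ hχ).mono (by simp)
  | some i :: w, x, y => by
    intro χ hχ
    simp only [relB] at hχ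
    have := small_compose (sa := s₁) (so := (w.length + 1) * (s₁ + 1)) (fun v α hα => ?_)
      (fun v y' => small_relB hs w v y') χ hχ
    · exact this.mono (by simp only [List.length_cons]; have := Nat.add_mul (w.length + 1) 1 (s₁ + 1); omega)
    · unfold atomBi at hα; split_ifs at hα
      · exact hs _ _ α hα
      · simp at hα
  | none :: w, x, y => by
    intro χ hχ
    simp only [relB] at hχ
    have := small_compose (sa := s₁) (so := (w.length + 1) * (s₁ + 1)) (fun v α hα => ?_)
      (fun v y' => small_relB hs w v y') χ hχ
    · exact this.mono (by simp only [List.length_cons]; have := Nat.add_mul (w.length + 1) 1 (s₁ + 1); omega)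
    · unfold atomBs at hα; exact hs _ _ α hα

/-- Auxiliary lemma `rB_mono` (bounded-depth Frege toolkit / Pudlák–Krajíček construction, see the section header). [cite: Krajicek2019, proof of Thm. 11.4.7] -/
theorem rB_mono {h cG : ℕ} (hh : 1 ≤ h) (hc : 1 ≤ cG) : ∀ {ℓ ℓ' : ℕ}, ℓ ≤ ℓ' → rB h cG ℓ ≤ rB h cG ℓ'
  | ℓ, 0, hle => by simp at hle; subst hle; exact le_rfl
  | ℓ, ℓ' + 1, hle => by
    rcases Nat.eq_or_lt_of_le hle with rfl | hlt
    · exact le_rfl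
    · have ih := rB_mono hh hc (Nat.lt_succ_iff.1 hlt)
      simp only [rB]
      calc rB h cG ℓ ≤ rB h cG ℓ' := ih
        _ = 1 * 1 * (1 * rB h cG ℓ') := by ring
        _ ≤ h * h * (cG * rB h cG ℓ') :=
          Nat.mul_le_mul (Nat.mul_le_mul hh hh) (Nat.mul_le_mul_right _ hc)

/-- Auxiliary lemma `one_le_rB` (bounded-depth Frege toolkit / Pudlák–Krajíček construction, see the section header). [cite: Krajicek2019, proof of Thm. 11.4.7] -/
theorem one_le_rB {h cG : ℕ} (hh : 1 ≤ h) (hc : 1 ≤ cG) (ℓ : ℕ) : 1 ≤ rB h cG ℓ :=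
  hc.trans (by simpa [rB] using rB_mono hh hc (Nat.zero_le ℓ))

/-- The components of the goodness formula: totality parts. [cite: Krajicek2019, proof of Thm. 11.4.7] -/
def totPart (R : Rel) (m n : ℕ) : List (PropForm ℕ) :=
  (List.range m).map fun x => disjList ((List.range n).flatMap (R x))

/-- The components of the goodness formula: disjointness parts. [cite: Krajicek2019, proof of Thm. 11.4.7] -/
def disjPart (R : Rel) (m n : ℕ) : List (PropForm ℕ) :=
  (List.range m).flatMap fun x => ((List.range m).filter fun x' => x ≠ x').flatMap fun x' =>
    (List.range n).flatMap fun y => (R x y).flatMap fun κ => (R x' y).map fun κ' =>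
      disj (neg κ) (neg κ')

/-- `good R m n`: the flat relation `R` is total on pigeons `< m` into holes `< n` and
disjoint. [cite: Krajicek2019, proof of Thm. 11.4.7] -/
def good (R : Rel) (m n : ℕ) : PropForm ℕ :=
  conjList (totPart R m n ++ disjPart R m n)

/-- The conjuncts of `low`: negated witnesses of block `i` into the upper holes `[half, n)`. [cite: Krajicek2019, proof of Thm. 11.4.7] -/
def lowList (R : Rel) (h n half i : ℕ) : List (PropForm ℕ) :=
  (List.range h).flatMap fun p =>
    ((List.range n).filter fun y => half ≤ y).flatMap fun y => (R (i * h + p) y).map neg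

/-- `low R h n half i`: no pigeon of block `i` reaches an upper hole. [cite: Krajicek2019, proof of Thm. 11.4.7] -/
def low (R : Rel) (h n half i : ℕ) : PropForm ℕ :=
  conjList (lowList R h n half i)

/-- Auxiliary lemma `mem_totPart` (bounded-depth Frege toolkit / Pudlák–Krajíček construction, see the section header). [cite: Krajicek2019, proof of Thm. 11.4.7] -/
theorem mem_totPart {R : Rel} {m n : ℕ} {A : PropForm ℕ} :
    A ∈ totPart R m n ↔ ∃ x < m, A = disjList ((List.range n).flatMap (R x)) := by
  simp only [totPart, List.mem_map, List.mem_range]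
  constructor
  · rintro ⟨x, hx, rfl⟩; exact ⟨x, hx, rfl⟩
  · rintro ⟨x, hx, rfl⟩; exact ⟨x, hx, rfl⟩

/-- Auxiliary lemma `mem_disjPart` (bounded-depth Frege toolkit / Pudlák–Krajíček construction, see the section header). [cite: Krajicek2019, proof of Thm. 11.4.7] -/
theorem mem_disjPart {R : Rel} {m n : ℕ} {A : PropForm ℕ} :
    A ∈ disjPart R m n ↔ ∃ x < m, ∃ x' < m, x ≠ x' ∧ ∃ y < n, ∃ κ ∈ R x y, ∃ κ' ∈ R x' y,
      A = disj (neg κ) (neg κ') := by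
  constructor
  · intro hA
    simp only [disjPart, List.mem_flatMap, List.mem_range, List.mem_filter, List.mem_map,
      decide_eq_true_eq] at hA
    obtain ⟨x, hx, x', ⟨hx', hxx⟩, y, hy, κ, hκ, κ', hκ', rfl⟩ := hA
    exact ⟨x, hx, x', hx', hxx, y, hy, κ, hκ, κ', hκ', rfl⟩
  · rintro ⟨x, hx, x', hx', hxx, y, hy, κ, hκ, κ', hκ', rfl⟩
    simp only [disjPart, List.mem_flatMap, List.mem_range, List.mem_filter, List.mem_map,
      decide_eq_true_eq]
    exact ⟨x, hx, x', ⟨hx', hxx⟩, y, hy, κ, hκ, κ', hκ', rfl⟩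

/-- Auxiliary lemma `mem_lowList` (bounded-depth Frege toolkit / Pudlák–Krajíček construction, see the section header). [cite: Krajicek2019, proof of Thm. 11.4.7] -/
theorem mem_lowList {R : Rel} {h n half i : ℕ} {A : PropForm ℕ} :
    A ∈ lowList R h n half i ↔ ∃ p < h, ∃ y, half ≤ y ∧ y < n ∧ ∃ κ ∈ R (i * h + p) y, A = neg κ := by
  constructor
  · intro hA
    simp only [lowList, List.mem_flatMap, List.mem_range, List.mem_filter, List.mem_map,
      decide_eq_true_eq] at hA
    obtain ⟨p, hp, y, ⟨hy2, hy1⟩, κ, hκ, rfl⟩ := hA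
    exact ⟨p, hp, y, hy1, hy2, κ, hκ, rfl⟩
  · rintro ⟨p, hp, y, hy1, hy2, κ, hκ, rfl⟩
    simp only [lowList, List.mem_flatMap, List.mem_range, List.mem_filter, List.mem_map,
      decide_eq_true_eq]
    exact ⟨p, hp, y, ⟨hy2, hy1⟩, κ, hκ, rfl⟩

/-- Auxiliary lemma `length_totPart` (bounded-depth Frege toolkit / Pudlák–Krajíček construction, see the section header). [cite: Krajicek2019, proof of Thm. 11.4.7] -/
theorem length_totPart (R : Rel) (m n : ℕ) : (totPart R m n).length = m := by
  simp [totPart]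

/-- Auxiliary lemma `length_disjPart_le` (bounded-depth Frege toolkit / Pudlák–Krajíček construction, see the section header). [cite: Krajicek2019, proof of Thm. 11.4.7] -/
theorem length_disjPart_le {R : Rel} {m n r : ℕ} (hr : ∀ x y, (R x y).length ≤ r) :
    (disjPart R m n).length ≤ m * (m * (n * (r * r))) := by
  unfold disjPart
  refine (length_flatMap_le _ _ (m * (n * (r * r))) fun x _ => ?_).trans (by simp)
  refine (length_flatMap_le _ _ (n * (r * r)) fun x' _ => ?_).trans ?_
  · refine (length_flatMap_le _ _ (r * r) fun y _ => ?_).trans (by simp)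
    refine (length_flatMap_le _ _ r fun κ _ => by simp [hr]).trans ?_
    exact Nat.mul_le_mul_right _ (hr _ _)
  · exact Nat.mul_le_mul_right _ ((List.length_filter_le _ _).trans (by simp))

/-- Auxiliary lemma `length_lowList_le` (bounded-depth Frege toolkit / Pudlák–Krajíček construction, see the section header). [cite: Krajicek2019, proof of Thm. 11.4.7] -/
theorem length_lowList_le {R : Rel} {h n half i r : ℕ} (hr : ∀ x y, (R x y).length ≤ r) :
    (lowList R h n half i).length ≤ h * (n * r) := by
  unfold lowList
  refine (length_flatMap_le _ _ (n * r) fun p _ => ?_).trans (by simp)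
  refine (length_flatMap_le _ _ r fun y _ => by simp [hr]).trans ?_
  exact Nat.mul_le_mul_right _ ((List.length_filter_le _ _).trans (by simp))

/-- Auxiliary lemma `altDepth_disj_le` (bounded-depth Frege toolkit / Pudlák–Krajíček construction, see the section header). [cite: Krajicek2019, proof of Thm. 11.4.7] -/
theorem altDepth_disj_le (A B : PropForm ℕ) :
    altDepth (disj A B) ≤ max (altDepth A) (altDepth B) + 1 := by
  have h1 := altDepthAux_le_altDepth 3 A
  have h2 := altDepthAux_le_altDepth 3 B
  show max (altDepthAux 3 A) (altDepthAux 3 B) + (if (0:ℕ) = 3 then 0 else 1) ≤ _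
  rw [if_neg (by decide)]
  have : max (altDepthAux 3 A) (altDepthAux 3 B) ≤ max (altDepth A) (altDepth B) := max_le_max h1 h2
  omega

/-- Auxiliary lemma `altDepth_conj_le` (bounded-depth Frege toolkit / Pudlák–Krajíček construction, see the section header). [cite: Krajicek2019, proof of Thm. 11.4.7] -/
theorem altDepth_conj_le (A B : PropForm ℕ) :
    altDepth (conj A B) ≤ max (altDepth A) (altDepth B) + 1 := by
  have h1 := altDepthAux_le_altDepth 2 A
  have h2 := altDepthAux_le_altDepth 2 B
  show max (altDepthAux 2 A) (altDepthAux 2 B) + (if (0:ℕ) = 2 then 0 else 1) ≤ _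
  rw [if_neg (by decide)]
  have : max (altDepthAux 2 A) (altDepthAux 2 B) ≤ max (altDepth A) (altDepth B) := max_le_max h1 h2
  omega

/-- Depth and size of the goodness formula. [cite: Krajicek2019, proof of Thm. 11.4.7] -/
theorem good_bounds {R : Rel} {m n r d s : ℕ} (hr : ∀ x y, (R x y).length ≤ r)
    (hs : ∀ x y, ∀ κ ∈ R x y, Small d s κ) :
    altDepth (good R m n) ≤ d + 4 ∧
      size (good R m n) ≤ (m + m * (m * (n * (r * r)))) * (n * r * (s + 1) + 2 * s + 5) + 1 := by
  have hmem : ∀ A ∈ totPart R m n ++ disjPart R m n,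
      altDepth A ≤ d + 3 ∧ size A ≤ n * r * (s + 1) + 2 * s + 4 := by
    intro A hA
    rw [List.mem_append] at hA
    rcases hA with hA | hA
    · obtain ⟨x, _, rfl⟩ := mem_totPart.1 hA
      have hL : ∀ B ∈ (List.range n).flatMap (R x), altDepth B ≤ d + 1 ∧ size B ≤ s := by
        intro B hB
        simp only [List.mem_flatMap, List.mem_range] at hB
        obtain ⟨y, _, hB⟩ := hB
        exact ⟨(hs x y B hB).altDepth_le, (hs x y B hB).2⟩
      refine ⟨(altDepth_disjList_le fun B hB => (hL B hB).1).trans (by omega), ?_⟩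
      refine (size_disjList_le fun B hB => (hL B hB).2).trans ?_
      have := length_flatMap_le (List.range n) (R x) r (fun y _ => hr x y)
      simp only [List.length_range] at this
      have := Nat.mul_le_mul_right (s + 1) this
      omega
    · obtain ⟨x, _, x', _, _, y, _, κ, hκ, κ', hκ', rfl⟩ := mem_disjPart.1 hA
      have h1 := (hs x y κ hκ).altDepth_le
      have h2 := (hs x' y κ' hκ').altDepth_le
      have h3 := altDepth_neg_le κ
      have h4 := altDepth_neg_le κ'
      refine ⟨?_, ?_⟩
      · have a1 := altDepth_disj_le (neg κ) (neg κ')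
        have : max (altDepth (neg κ)) (altDepth (neg κ')) ≤ d + 2 := max_le (by omega) (by omega)
        omega
      · have := (hs x y κ hκ).2; have := (hs x' y κ' hκ').2
        simp [size]; omega
  refine ⟨(altDepth_conjList_le fun A hA => (hmem A hA).1), ?_⟩
  refine (size_conjList_le fun A hA => (hmem A hA).2).trans ?_
  have hl : (totPart R m n ++ disjPart R m n).length ≤ m + m * (m * (n * (r * r))) := by
    rw [List.length_append, length_totPart]
    have := length_disjPart_le (m := m) (n := n) hr
    omega
  have := Nat.mul_le_mul_right (n * r * (s + 1) + 2 * s + 4 + 1) hl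
  rw [show n * r * (s + 1) + 2 * s + 4 + 1 = n * r * (s + 1) + 2 * s + 5 from rfl] at this ⊢
  omega

/-- Depth and size of the lowness formula. [cite: Krajicek2019, proof of Thm. 11.4.7] -/
theorem low_bounds {R : Rel} {h n half i r d s : ℕ} (hr : ∀ x y, (R x y).length ≤ r)
    (hs : ∀ x y, ∀ κ ∈ R x y, Small d s κ) :
    altDepth (low R h n half i) ≤ d + 3 ∧ size (low R h n half i) ≤ h * (n * r) * (s + 2) + 1 := by
  have hmem : ∀ A ∈ lowList R h n half i, altDepth A ≤ d + 2 ∧ size A ≤ s + 1 := by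
    intro A hA
    obtain ⟨p, _, y, _, _, κ, hκ, rfl⟩ := mem_lowList.1 hA
    exact ⟨(altDepth_neg_le κ).trans (by have := (hs _ _ κ hκ).altDepth_le; omega),
      by have := (hs _ _ κ hκ).2; simp [size]; omega⟩
  refine ⟨altDepth_conjList_le fun A hA => (hmem A hA).1, ?_⟩
  refine (size_conjList_le fun A hA => (hmem A hA).2).trans ?_
  have := Nat.mul_le_mul_right (s + 1 + 1) (length_lowList_le (h := h) (n := n) (half := half) (i := i) hr)
  rw [show s + 1 + 1 = s + 2 from rfl] at this ⊢
  omega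

end PhaseBDefs


/-! ### L8. Introducing and using the goodness formula -/

section Good

variable {Q : SPrm}

/-- Auxiliary lemma `base_of_mem_conjList` (bounded-depth Frege toolkit / Pudlák–Krajíček construction, see the section header). [cite: Krajicek2019, proof of Thm. 11.4.7] -/
theorem base_of_mem_conjList {L : List (PropForm ℕ)} {A : PropForm ℕ} (h : Base Q (conjList L))
    (hA : A ∈ L) : Base Q A := by
  induction L with
  | nil => exact absurd hA List.not_mem_nil
  | cons B L ih =>
    rw [conjList_cons] at h
    rcases List.mem_cons.1 hA with rfl | hA
    · exact h.of_conj_left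
    · exact ih h.of_conj_right hA

/-- Auxiliary lemma `length_components_le` (bounded-depth Frege toolkit / Pudlák–Krajíček construction, see the section header). [cite: Krajicek2019, proof of Thm. 11.4.7] -/
theorem length_components_le {R : Rel} {m n r : ℕ} (hr : ∀ x y, (R x y).length ≤ r) :
    (totPart R m n ++ disjPart R m n).length ≤ m + m * (m * (n * (r * r))) := by
  rw [List.length_append, length_totPart]
  have := length_disjPart_le (m := m) (n := n) hr
  omega

/-- **Goodness introduction**: a total disjoint flat relation satisfies `good`. [cite: Krajicek2019, proof of Thm. 11.4.7] -/
theorem goodIntro {R : Rel} {m n r t : ℕ} {Γ' : List (PropForm ℕ)}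
    (hT : TotR Q t Γ' m n R) (hD : DisjR Q t Γ' m n R) (hr : ∀ x y, (R x y).length ≤ r)
    (hΓ' : ∀ A ∈ Γ', Base Q A) (hbG : Base Q (good R m n))
    (hW : Γ'.length + n * r + 2 ≤ Q.W) :
    Sq Q ((m + m * (m * (n * (r * r)))) * (t + 3 * (n * r) + 4) + 1) (good R m n :: Γ') := by
  unfold good
  have hcomp : ∀ A ∈ totPart R m n ++ disjPart R m n, Sq Q (t + 3 * (n * r) + 3) (A :: Γ') := by
    intro A hA
    rw [List.mem_append] at hA
    rcases hA with hA | hA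
    · obtain ⟨x, hx, rfl⟩ := mem_totPart.1 hA
      have hlen := length_flatMap_le (List.range n) (R x) r (fun y _ => hr x y)
      simp only [List.length_range] at hlen
      have hbT : Base Q (disjList ((List.range n).flatMap (R x))) :=
        base_of_mem_conjList hbG (by rw [List.mem_append]; exact Or.inl hA)
      have h1 : Sq Q (t + 1) ((List.range n).flatMap (R x) ++ Γ') :=
        (hT x hx).weaken₂ _ (by intro C hC; simp only [List.mem_append] at hC ⊢; tauto)
          (by intro C hC; simp only [List.mem_append] at hC ⊢; tauto)
          (by have := (hT x hx).length_le; simp only [List.length_append] at this ⊢; omega)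
      have h2 := Sq.orIntro _ h1 hbT (by omega)
      refine h2.mono ?_
      have := Nat.mul_le_mul_left 3 hlen
      omega
    · obtain ⟨x, hx, x', hx', hxx, y, hy, κ, hκ, κ', hκ', rfl⟩ := mem_disjPart.1 hA
      have hbD : Base Q (disj (neg κ) (neg κ')) :=
        base_of_mem_conjList hbG (by rw [List.mem_append]; exact Or.inr hA)
      exact (Sq.consDisj (hD x hx x' hx' hxx y hy κ hκ κ' hκ') hbD).mono (by omega)
  have h3 := Sq.andIntro hΓ' (by omega) (totPart R m n ++ disjPart R m n) hbG hcomp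
  refine h3.mono ?_
  have := Nat.mul_le_mul_right (t + 3 * (n * r) + 3 + 1) (length_components_le (m := m) (n := n) hr)
  rw [show t + 3 * (n * r) + 3 + 1 = t + 3 * (n * r) + 4 from rfl] at this ⊢
  omega

/-- Auxiliary lemma `base_of_mem_disjList` (bounded-depth Frege toolkit / Pudlák–Krajíček construction, see the section header). [cite: Krajicek2019, proof of Thm. 11.4.7] -/
theorem base_of_mem_disjList {L : List (PropForm ℕ)} {A : PropForm ℕ} (h : Base Q (disjList L))
    (hA : A ∈ L) : Base Q A := by
  induction L with
  | nil => exact absurd hA List.not_mem_nil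
  | cons B L ih =>
    rw [disjList_cons] at h
    rcases List.mem_cons.1 hA with rfl | hA
    · exact h.of_disj_left
    · exact ih h.of_disj_right hA

/-- **Goodness elimination, totality**: in a context containing `¬ good`, the relation is
(virtually) total. [cite: Krajicek2019, proof of Thm. 11.4.7] -/
theorem goodElim_tot {R : Rel} {m n r : ℕ} {Ξ : List (PropForm ℕ)}
    (hr : ∀ x y, (R x y).length ≤ r) (hΞ : ∀ A ∈ Ξ, Base Q A) (hbG : Base Q (good R m n))
    (hbnG : Base Q (neg (good R m n)))
    (hbnT : ∀ x < m, Base Q (neg (disjList ((List.range n).flatMap (R x)))))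
    (hW : Ξ.length + n * r + 3 ≤ Q.W) :
    TotR Q (3 * (n * r) + 2 * (m + m * (m * (n * (r * r)))) + 6) (neg (good R m n) :: Ξ) m n R := by
  intro x hx
  set Tx := (List.range n).flatMap (R x) with hTx
  have hlen : Tx.length ≤ n * r := by
    have := length_flatMap_le (List.range n) (R x) r (fun y _ => hr x y)
    simpa [hTx] using this
  have hmemT : disjList Tx ∈ totPart R m n ++ disjPart R m n := by
    rw [List.mem_append]; exact Or.inl (mem_totPart.2 ⟨x, hx, rfl⟩)
  have hbT : Base Q (disjList Tx) := base_of_mem_conjList hbG hmemT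
  have hbnTx : Base Q (neg (disjList Tx)) := hbnT x hx
  have hTxB : ∀ C ∈ Tx, Base Q C := fun C hC => base_of_mem_disjList hbT hC
  have s0 : Sq Q 1 (disjList Tx :: neg (disjList Tx) :: Ξ) :=
    Sq.ax (A := disjList Tx) (by
      intro C hC; simp only [List.mem_cons] at hC
      rcases hC with rfl | rfl | hC
      · exact hbT
      · exact hbnTx
      · exact hΞ C hC) (by simp; omega) (by simp) (by simp)
  have s1 : Sq Q (1 + 3 * Tx.length + 3) (Tx ++ neg (disjList Tx) :: Ξ) :=
    Sq.unDisjList Tx s0 (by simp; omega)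
  have s2 : Sq Q (1 + 3 * Tx.length + 3 + 1) (neg (disjList Tx) :: (Ξ ++ Tx)) :=
    s1.weaken₂ _ (by intro C hC; simp only [List.mem_cons, List.mem_append] at hC ⊢; tauto)
      (by intro C hC; simp only [List.mem_cons, List.mem_append] at hC ⊢; tauto) (by simp; omega)
  have s3 := Sq.negAndOfMem (L := Ξ ++ Tx) (by simp; omega) (totPart R m n ++ disjPart R m n)
    hmemT hbnG s2
  unfold good
  refine s3.mono ?_
  have := length_components_le (m := m) (n := n) hr
  omega

/-- **Goodness elimination, disjointness**: in a context containing `¬ good`, the relation is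
(virtually) disjoint. [cite: Krajicek2019, proof of Thm. 11.4.7] -/
theorem goodElim_disj {R : Rel} {m n r : ℕ} {Ξ : List (PropForm ℕ)}
    (hr : ∀ x y, (R x y).length ≤ r) (hΞ : ∀ A ∈ Ξ, Base Q A) (hbG : Base Q (good R m n))
    (hbnG : Base Q (neg (good R m n)))
    (hbnD : ∀ x < m, ∀ x' < m, ∀ y < n, ∀ κ ∈ R x y, ∀ κ' ∈ R x' y,
      Base Q (neg (disj (neg κ) (neg κ'))))
    (hW : Ξ.length + 5 ≤ Q.W) :
    DisjR Q (2 * (m + m * (m * (n * (r * r)))) + 4) (neg (good R m n) :: Ξ) m n R := by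
  intro x hx x' hx' hxx y hy κ hκ κ' hκ'
  set D := disj (neg κ) (neg κ') with hDdef
  have hmemD : D ∈ totPart R m n ++ disjPart R m n := by
    rw [List.mem_append]; exact Or.inr (mem_disjPart.2 ⟨x, hx, x', hx', hxx, y, hy, κ, hκ, κ', hκ', rfl⟩)
  have hbD : Base Q D := base_of_mem_conjList hbG hmemD
  have hbnD' : Base Q (neg D) := hbnD x hx x' hx' y hy κ hκ κ' hκ'
  have s0 : Sq Q 1 (D :: neg D :: Ξ) :=
    Sq.ax (A := D) (by
      intro C hC; simp only [List.mem_cons] at hC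
      rcases hC with rfl | rfl | hC
      · exact hbD
      · exact hbnD'
      · exact hΞ C hC) (by simp; omega) (by simp) (by simp)
  have s1 : Sq Q 2 (neg κ :: neg κ' :: neg D :: Ξ) := (Sq.unDisj s0 (by simp; omega)).mono (by omega)
  have s2 : Sq Q 3 (neg D :: neg κ :: neg κ' :: Ξ) :=
    (s1.weaken₂ _ (by intro C hC; simp only [List.mem_cons] at hC ⊢; tauto)
      (by intro C hC; simp only [List.mem_cons] at hC ⊢; tauto) (by simp; omega)).mono (by omega)
  have s3 := Sq.negAndOfMem (L := neg κ :: neg κ' :: Ξ) (by simp; omega)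
    (totPart R m n ++ disjPart R m n) hmemD hbnG s2
  have s4 := s3.weaken₂ (neg κ :: neg κ' :: neg (conjList (totPart R m n ++ disjPart R m n)) :: Ξ)
    (by intro C hC; simp only [List.mem_cons] at hC ⊢; tauto)
    (by intro C hC; simp only [List.mem_cons] at hC ⊢; tauto) (by simp; omega)
  unfold good
  refine s4.mono ?_
  have := length_components_le (m := m) (n := n) hr
  omega

end Good


/-! ### L9. Bounding ticks by powers of one parameter `X` -/

section XBounds

variable {X : ℕ}

/-- Auxiliary lemma `xb_mul` (bounded-depth Frege toolkit / Pudlák–Krajíček construction, see the section header). [folklore] -/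
theorem xb_mul {a b i j : ℕ} (ha : a ≤ X ^ i) (hb : b ≤ X ^ j) : a * b ≤ X ^ (i + j) := by
  rw [pow_add]; exact Nat.mul_le_mul ha hb

/-- Auxiliary lemma `xb_add` (bounded-depth Frege toolkit / Pudlák–Krajíček construction, see the section header). [folklore] -/
theorem xb_add {a b i : ℕ} (hX : 2 ≤ X) (ha : a ≤ X ^ i) (hb : b ≤ X ^ i) :
    a + b ≤ X ^ (i + 1) := by
  rw [pow_succ]
  calc a + b ≤ X ^ i + X ^ i := add_le_add ha hb
    _ = X ^ i * 2 := by ring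
    _ ≤ X ^ i * X := Nat.mul_le_mul_left _ hX

/-- Auxiliary lemma `xb_le` (bounded-depth Frege toolkit / Pudlák–Krajíček construction, see the section header). [folklore] -/
theorem xb_le {a i j : ℕ} (hX : 2 ≤ X) (ha : a ≤ X ^ i) (hij : i ≤ j) : a ≤ X ^ j :=
  ha.trans (Nat.pow_le_pow_right (by omega) hij)

/-- Auxiliary lemma `xb_const` (bounded-depth Frege toolkit / Pudlák–Krajíček construction, see the section header). [folklore] -/
theorem xb_const {c : ℕ} (i : ℕ) (hX : 2 ≤ X) (hc : c ≤ 2 ^ i) : c ≤ X ^ i :=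
  hc.trans (Nat.pow_le_pow_left hX i)

/-- Auxiliary lemma `xb_one` (bounded-depth Frege toolkit / Pudlák–Krajíček construction, see the section header). [folklore] -/
theorem xb_one {a : ℕ} (ha : a ≤ X) : a ≤ X ^ 1 := by simpa using ha

/-- Auxiliary lemma `xb_self` (bounded-depth Frege toolkit / Pudlák–Krajíček construction, see the section header). [folklore] -/
theorem xb_self (hX : 2 ≤ X) (i : ℕ) (hi : 1 ≤ i) : X ≤ X ^ i := by
  calc X = X ^ 1 := (pow_one X).symm
    _ ≤ X ^ i := Nat.pow_le_pow_right (by omega) hi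

end XBounds

/-! ### L10. The halving induction: parameter bundle and base formulas -/

/-- Size budget for the halving argument. [cite: Krajicek2019, proof of Thm. 11.4.7] -/
def hbM (h e s₁ cG : ℕ) : ℕ :=
  let rmax := rB h cG e
  let smax := (e + 2) * (s₁ + 1)
  let gc := h * h + h * h * (h * h * (h * (rmax * rmax)))
  gc * (h * rmax * (smax + 1) + 2 * smax + 5) + 1 + (h * (h * rmax) * (smax + 2) + 1) + 8

/-- Sequent-length budget for the halving argument. [cite: Krajicek2019, proof of Thm. 11.4.7] -/
def hbW (h e cG Γl : ℕ) : ℕ :=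
  Γl + 2 * (h + 1) ^ e + h * cG + 4 * (h * rB h cG e) + 4 * h + 20

/-- Parameter bundle of the halving argument (Krajíček 2019, §11.4, proof of Thm. 11.4.7). [cite: Krajicek2019, proof of Thm. 11.4.7] -/
structure HB (Q : SPrm) where
  /-- the flat relation `[h²] → [h]` to be refuted -/
  G : Rel
  /-- the ambient context -/
  Γ : List (PropForm ℕ)
  /-- number of holes `h = 2^e` -/
  h : ℕ
  /-- logarithm of the number of holes -/
  e : ℕ
  /-- ticks of the hypotheses on `G` -/
  tG : ℕ
  /-- depth invariant of the witnesses of `G` -/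
  d : ℕ
  /-- size bound of the witnesses of `G` -/
  s₁ : ℕ
  /-- witness-count bound of `G` -/
  cG : ℕ
  /-- the master bound -/
  X : ℕ
  /-- `he` -/
  he : 1 ≤ e
  /-- `hh` -/
  hh : h = 2 ^ e
  /-- `hΓ` -/
  hΓ : ∀ A ∈ Γ, Base Q A
  /-- `hTot` -/
  hTot : TotR Q tG Γ (h * h) h G
  /-- `hDisj` -/
  hDisj : DisjR Q tG Γ (h * h) h G
  /-- `hsmall` -/
  hsmall : ∀ x y, ∀ κ ∈ G x y, Small d s₁ κ
  /-- `hcG` -/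
  hcG : ∀ x y, (G x y).length ≤ cG
  /-- `hcG1` -/
  hcG1 : 1 ≤ cG
  /-- `hQD` -/
  hQD : d + 6 ≤ Q.D
  /-- `hQM` -/
  hQM : hbM h e s₁ cG ≤ Q.M
  /-- `hQW` -/
  hQW : hbW h e cG Γ.length ≤ Q.W
  /-- `hX2` -/
  hX2 : 2 ≤ X
  /-- `hXh` -/
  hXh : h + 1 ≤ X
  /-- `hXc` -/
  hXc : cG ≤ X
  /-- `hXr` -/
  hXr : rB h cG e ≤ X
  /-- `hXt` -/
  hXt : tG ≤ X
  /-- `hXp` -/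
  hXp : (h + 1) ^ e ≤ X
  /-- `hXΓ` -/
  hXΓ : Γ.length ≤ X

namespace HB

variable {Q : SPrm} (P : HB Q)

/-- The level relations. [cite: Krajicek2019, proof of Thm. 11.4.7] -/
def R (w : List (Option ℕ)) : Rel := relB P.G P.h P.e w

/-- Hole range at level `ℓ`. [cite: Krajicek2019, proof of Thm. 11.4.7] -/
def nB (ℓ : ℕ) : ℕ := 2 ^ (P.e - ℓ)

/-- Number of pigeons. [cite: Krajicek2019, proof of Thm. 11.4.7] -/
def m : ℕ := P.h * P.h

/-- Witness bound. [cite: Krajicek2019, proof of Thm. 11.4.7] -/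
def rmax : ℕ := rB P.h P.cG P.e

/-- Size bound of chains. [cite: Krajicek2019, proof of Thm. 11.4.7] -/
def smax : ℕ := (P.e + 2) * (P.s₁ + 1)

/-- Bound on the number of goodness components. [cite: Krajicek2019, proof of Thm. 11.4.7] -/
def gc : ℕ := P.h * P.h + P.h * P.h * (P.h * P.h * (P.h * (P.rmax * P.rmax)))

/-- Bound on the number of lowness components. [cite: Krajicek2019, proof of Thm. 11.4.7] -/
def lc : ℕ := P.h * (P.h * P.rmax)

/-- The goodness formula of level `|w|`. [cite: Krajicek2019, proof of Thm. 11.4.7] -/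
def goodW (w : List (Option ℕ)) : PropForm ℕ := good (P.R w) P.m (P.nB w.length)

/-- The lowness formula of block `i` at level `|w|`. [cite: Krajicek2019, proof of Thm. 11.4.7] -/
def lowW (w : List (Option ℕ)) (i : ℕ) : PropForm ℕ :=
  low (P.R w) P.h (P.nB w.length) (P.nB (w.length + 1)) i

/-- Auxiliary lemma `two_le_h` (bounded-depth Frege toolkit / Pudlák–Krajíček construction, see the section header). [cite: Krajicek2019, proof of Thm. 11.4.7] -/
theorem two_le_h : 2 ≤ P.h := by
  rw [P.hh]
  calc 2 = 2 ^ 1 := rfl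
    _ ≤ 2 ^ P.e := Nat.pow_le_pow_right (by norm_num) P.he

/-- Auxiliary lemma `one_le_h` (bounded-depth Frege toolkit / Pudlák–Krajíček construction, see the section header). [cite: Krajicek2019, proof of Thm. 11.4.7] -/
theorem one_le_h : 1 ≤ P.h := le_trans (by norm_num) P.two_le_h

/-- Auxiliary lemma `e_le_h` (bounded-depth Frege toolkit / Pudlák–Krajíček construction, see the section header). [cite: Krajicek2019, proof of Thm. 11.4.7] -/
theorem e_le_h : P.e ≤ P.h := by rw [P.hh]; exact (Nat.lt_two_pow_self).le

/-- Auxiliary lemma `nB_le_h` (bounded-depth Frege toolkit / Pudlák–Krajíček construction, see the section header). [cite: Krajicek2019, proof of Thm. 11.4.7] -/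
theorem nB_le_h (ℓ : ℕ) : P.nB ℓ ≤ P.h := by
  rw [P.hh]; exact Nat.pow_le_pow_right (by norm_num) (Nat.sub_le _ _)

/-- Auxiliary lemma `nB_zero` (bounded-depth Frege toolkit / Pudlák–Krajíček construction, see the section header). [cite: Krajicek2019, proof of Thm. 11.4.7] -/
theorem nB_zero : P.nB 0 = P.h := by simp [nB, P.hh]

/-- Auxiliary lemma `nB_succ` (bounded-depth Frege toolkit / Pudlák–Krajíček construction, see the section header). [cite: Krajicek2019, proof of Thm. 11.4.7] -/
theorem nB_succ {ℓ : ℕ} (hℓ : ℓ < P.e) : P.nB ℓ = 2 * P.nB (ℓ + 1) := by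
  simp only [nB]
  rw [show P.e - ℓ = (P.e - (ℓ + 1)) + 1 from by omega, pow_succ]; ring

/-- Auxiliary lemma `nB_e` (bounded-depth Frege toolkit / Pudlák–Krajíček construction, see the section header). [cite: Krajicek2019, proof of Thm. 11.4.7] -/
theorem nB_e : P.nB P.e = 1 := by simp [nB]

/-- Auxiliary lemma `one_le_nB` (bounded-depth Frege toolkit / Pudlák–Krajíček construction, see the section header). [cite: Krajicek2019, proof of Thm. 11.4.7] -/
theorem one_le_nB (ℓ : ℕ) : 1 ≤ P.nB ℓ := Nat.one_le_two_pow

/-- Auxiliary lemma `length_R_le` (bounded-depth Frege toolkit / Pudlák–Krajíček construction, see the section header). [cite: Krajicek2019, proof of Thm. 11.4.7] -/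
theorem length_R_le (w : List (Option ℕ)) (x y : ℕ) : (P.R w x y).length ≤ rB P.h P.cG w.length :=
  length_relB_le P.hcG w x y

/-- Auxiliary lemma `rB_le_rmax` (bounded-depth Frege toolkit / Pudlák–Krajíček construction, see the section header). [cite: Krajicek2019, proof of Thm. 11.4.7] -/
theorem rB_le_rmax {ℓ : ℕ} (hℓ : ℓ ≤ P.e) : rB P.h P.cG ℓ ≤ P.rmax :=
  rB_mono P.one_le_h P.hcG1 hℓ

/-- Auxiliary lemma `length_R_le'` (bounded-depth Frege toolkit / Pudlák–Krajíček construction, see the section header). [cite: Krajicek2019, proof of Thm. 11.4.7] -/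
theorem length_R_le' {w : List (Option ℕ)} (hw : w.length ≤ P.e) (x y : ℕ) :
    (P.R w x y).length ≤ P.rmax :=
  (P.length_R_le w x y).trans (P.rB_le_rmax hw)

/-- Auxiliary lemma `one_le_rmax` (bounded-depth Frege toolkit / Pudlák–Krajíček construction, see the section header). [cite: Krajicek2019, proof of Thm. 11.4.7] -/
theorem one_le_rmax : 1 ≤ P.rmax := one_le_rB P.one_le_h P.hcG1 _

/-- Auxiliary lemma `small_R` (bounded-depth Frege toolkit / Pudlák–Krajíček construction, see the section header). [cite: Krajicek2019, proof of Thm. 11.4.7] -/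
theorem small_R {w : List (Option ℕ)} (hw : w.length ≤ P.e) (x y : ℕ) :
    ∀ χ ∈ P.R w x y, Small P.d P.smax χ := fun χ hχ =>
  (small_relB P.hsmall w x y χ hχ).mono (Nat.mul_le_mul_right _ (by omega))

/-- Auxiliary lemma `comps_le` (bounded-depth Frege toolkit / Pudlák–Krajíček construction, see the section header). [cite: Krajicek2019, proof of Thm. 11.4.7] -/
theorem comps_le {n r : ℕ} (hn : n ≤ P.h) (hr : r ≤ P.rmax) :
    P.m + P.m * (P.m * (n * (r * r))) ≤ P.gc := by
  unfold gc m
  have : n * (r * r) ≤ P.h * (P.rmax * P.rmax) := Nat.mul_le_mul hn (Nat.mul_le_mul hr hr)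
  have := Nat.mul_le_mul_left (P.h * P.h) (Nat.mul_le_mul_left (P.h * P.h) this)
  omega

/-- Auxiliary lemma `lows_le` (bounded-depth Frege toolkit / Pudlák–Krajíček construction, see the section header). [cite: Krajicek2019, proof of Thm. 11.4.7] -/
theorem lows_le {n r : ℕ} (hn : n ≤ P.h) (hr : r ≤ P.rmax) : P.h * (n * r) ≤ P.lc := by
  unfold lc
  exact Nat.mul_le_mul_left _ (Nat.mul_le_mul hn hr)

/-- Auxiliary lemma `smax_le_M` (bounded-depth Frege toolkit / Pudlák–Krajíček construction, see the section header). [cite: Krajicek2019, proof of Thm. 11.4.7] -/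
theorem smax_le_M : P.smax + 2 ≤ Q.M := by
  have := P.hQM
  simp only [hbM] at this
  have h1 : 1 ≤ P.h * P.h := Nat.mul_le_mul P.one_le_h P.one_le_h
  have : P.smax ≤ (P.h * P.h + P.h * P.h * (P.h * P.h * (P.h * (rB P.h P.cG P.e * rB P.h P.cG P.e)))) *
      (P.h * rB P.h P.cG P.e * (P.smax + 1) + 2 * P.smax + 5) := by
    calc P.smax ≤ 1 * (2 * P.smax) := by omega
      _ ≤ _ := Nat.mul_le_mul (by omega) (by omega)
  unfold smax at *
  omega

/-- Chains and their (double) negations are base formulas. [cite: Krajicek2019, proof of Thm. 11.4.7] -/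
theorem base_chain {w : List (Option ℕ)} (hw : w.length ≤ P.e) {x y : ℕ} {χ : PropForm ℕ}
    (hχ : χ ∈ P.R w x y) : Base Q χ ∧ Base Q (neg χ) ∧ Base Q (neg (neg χ)) :=
  (P.small_R hw x y χ hχ).base (by have := P.hQD; omega) P.smax_le_M

/-- Auxiliary lemma `base_G` (bounded-depth Frege toolkit / Pudlák–Krajíček construction, see the section header). [cite: Krajicek2019, proof of Thm. 11.4.7] -/
theorem base_G {x y : ℕ} {χ : PropForm ℕ} (hχ : χ ∈ P.G x y) :
    Base Q χ ∧ Base Q (neg χ) ∧ Base Q (neg (neg χ)) :=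
  P.base_chain (w := []) (by simp) (by simpa [R, relB] using hχ)

/-- Auxiliary lemma `gmax_le_M` (bounded-depth Frege toolkit / Pudlák–Krajíček construction, see the section header). [cite: Krajicek2019, proof of Thm. 11.4.7] -/
theorem gmax_le_M : P.gc * (P.h * P.rmax * (P.smax + 1) + 2 * P.smax + 5) + 1 + 1 ≤ Q.M := by
  have := P.hQM; simp only [hbM] at this; unfold gc rmax smax at *; omega

/-- Auxiliary lemma `lmax_le_M` (bounded-depth Frege toolkit / Pudlák–Krajíček construction, see the section header). [cite: Krajicek2019, proof of Thm. 11.4.7] -/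
theorem lmax_le_M : P.h * (P.h * P.rmax) * (P.smax + 2) + 1 + 1 ≤ Q.M := by
  have := P.hQM; simp only [hbM] at this; unfold rmax smax at *; omega

/-- The list-disjunction of the witnesses of one pigeon, and its negation, are base. [cite: Krajicek2019, proof of Thm. 11.4.7] -/
theorem base_Tx {w : List (Option ℕ)} (hw : w.length ≤ P.e) {n : ℕ} (hn : n ≤ P.h) (x : ℕ) :
    Base Q (disjList ((List.range n).flatMap (P.R w x))) ∧
      Base Q (neg (disjList ((List.range n).flatMap (P.R w x)))) := by
  have hmem : ∀ B ∈ (List.range n).flatMap (P.R w x), altDepth B ≤ P.d + 1 ∧ size B ≤ P.smax := by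
    intro B hB
    simp only [List.mem_flatMap, List.mem_range] at hB
    obtain ⟨y, _, hB⟩ := hB
    exact ⟨(P.small_R hw x y B hB).altDepth_le, (P.small_R hw x y B hB).2⟩
  have hd := altDepth_disjList_le fun B hB => (hmem B hB).1
  have hs := size_disjList_le fun B hB => (hmem B hB).2
  have hl : ((List.range n).flatMap (P.R w x)).length ≤ P.h * P.rmax := by
    refine (length_flatMap_le _ _ P.rmax fun y _ => P.length_R_le' hw x y).trans ?_
    simpa using Nat.mul_le_mul_right P.rmax hn
  have hM := P.gmax_le_M
  have hD := P.hQD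
  have hgc : 1 ≤ P.gc := by
    unfold gc; have := Nat.mul_le_mul P.one_le_h P.one_le_h; omega
  have hs' : size (disjList ((List.range n).flatMap (P.R w x))) ≤
      P.h * P.rmax * (P.smax + 1) + 1 := by
    refine hs.trans ?_
    have := Nat.mul_le_mul_right (P.smax + 1) hl
    omega
  have hbig : P.h * P.rmax * (P.smax + 1) + 1 + 1 ≤ Q.M := by
    have : P.h * P.rmax * (P.smax + 1) + 2 * P.smax + 5 ≤
        P.gc * (P.h * P.rmax * (P.smax + 1) + 2 * P.smax + 5) := by
      calc _ = 1 * (P.h * P.rmax * (P.smax + 1) + 2 * P.smax + 5) := (one_mul _).symm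
        _ ≤ _ := Nat.mul_le_mul_right _ hgc
    omega
  refine ⟨⟨by omega, by omega⟩, ⟨(altDepth_neg_le _).trans (by omega), by simp [size]; omega⟩⟩

/-- The goodness formula and its negation are base. [cite: Krajicek2019, proof of Thm. 11.4.7] -/
theorem base_good {w : List (Option ℕ)} (hw : w.length ≤ P.e) {n : ℕ} (hn : n ≤ P.h) :
    Base Q (good (P.R w) P.m n) ∧ Base Q (neg (good (P.R w) P.m n)) := by
  have hb := good_bounds (m := P.m) (n := n) (fun x y => P.length_R_le' hw x y) (fun x y => P.small_R hw x y)
  have h1 := P.comps_le hn le_rfl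
  have h2 : n * P.rmax * (P.smax + 1) + 2 * P.smax + 5 ≤ P.h * P.rmax * (P.smax + 1) + 2 * P.smax + 5 := by
    have := Nat.mul_le_mul_right (P.smax + 1) (Nat.mul_le_mul_right P.rmax hn); omega
  have h3 := Nat.mul_le_mul h1 h2
  have hM := P.gmax_le_M
  have hD := P.hQD
  refine ⟨⟨by omega, by omega⟩, ⟨(altDepth_neg_le _).trans (by omega), by simp [size]; omega⟩⟩

/-- The lowness formula and its negation are base. [cite: Krajicek2019, proof of Thm. 11.4.7] -/
theorem base_low {w : List (Option ℕ)} (hw : w.length ≤ P.e) {n half : ℕ} (hn : n ≤ P.h) (i : ℕ) :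
    Base Q (low (P.R w) P.h n half i) ∧ Base Q (neg (low (P.R w) P.h n half i)) := by
  have hb := low_bounds (h := P.h) (n := n) (half := half) (i := i)
    (fun x y => P.length_R_le' hw x y) (fun x y => P.small_R hw x y)
  have h1 : P.h * (n * P.rmax) * (P.smax + 2) ≤ P.h * (P.h * P.rmax) * (P.smax + 2) :=
    Nat.mul_le_mul_right _ (Nat.mul_le_mul_left _ (Nat.mul_le_mul_right _ hn))
  have hM := P.lmax_le_M
  have hD := P.hQD
  refine ⟨⟨by omega, by omega⟩, ⟨(altDepth_neg_le _).trans (by omega), by simp [size]; omega⟩⟩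

/-- Disjointness components and their negations are base. [cite: Krajicek2019, proof of Thm. 11.4.7] -/
theorem base_D {w : List (Option ℕ)} (hw : w.length ≤ P.e) {x y x' y' : ℕ} {κ κ' : PropForm ℕ}
    (hκ : κ ∈ P.R w x y) (hκ' : κ' ∈ P.R w x' y') :
    Base Q (disj (neg κ) (neg κ')) ∧ Base Q (neg (disj (neg κ) (neg κ'))) := by
  have s1 := P.small_R hw x y κ hκ
  have s2 := P.small_R hw x' y' κ' hκ'
  have d1 := (altDepth_neg_le κ).trans (Nat.add_le_add_right s1.altDepth_le 1)
  have d2 := (altDepth_neg_le κ').trans (Nat.add_le_add_right s2.altDepth_le 1)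
  have d3 := altDepth_disj_le (neg κ) (neg κ')
  have d4 : max (altDepth (neg κ)) (altDepth (neg κ')) ≤ P.d + 2 := max_le d1 d2
  have hM := P.gmax_le_M
  have hD := P.hQD
  have hgc : 1 ≤ P.gc := by
    unfold gc; have := Nat.mul_le_mul P.one_le_h P.one_le_h; omega
  have hbig : 2 * P.smax + 5 ≤ Q.M := by
    have : 2 * P.smax + 5 ≤ P.gc * (P.h * P.rmax * (P.smax + 1) + 2 * P.smax + 5) := by
      calc _ ≤ 1 * (P.h * P.rmax * (P.smax + 1) + 2 * P.smax + 5) := by omega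
        _ ≤ _ := Nat.mul_le_mul_right _ hgc
    omega
  have z1 := s1.2; have z2 := s2.2
  refine ⟨⟨by omega, by simp [size]; omega⟩, ⟨(altDepth_neg_le _).trans (by omega), by simp [size]; omega⟩⟩

/-- Useful `X`-bounds of the derived quantities. [cite: Krajicek2019, proof of Thm. 11.4.7] -/
theorem h_le_X : P.h ≤ P.X := by have := P.hXh; omega

/-- Auxiliary lemma `gc_le` (bounded-depth Frege toolkit / Pudlák–Krajíček construction, see the section header). [cite: Krajicek2019, proof of Thm. 11.4.7] -/
theorem gc_le : P.gc ≤ P.X ^ 8 := by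
  have hX := P.hX2
  have a : P.h * P.h ≤ P.X ^ 2 := xb_mul (xb_one P.h_le_X) (xb_one P.h_le_X)
  have b : P.rmax * P.rmax ≤ P.X ^ 2 := xb_mul (xb_one P.hXr) (xb_one P.hXr)
  have c : P.h * (P.rmax * P.rmax) ≤ P.X ^ 3 := xb_mul (i := 1) (xb_one P.h_le_X) b
  have d : P.h * P.h * (P.h * (P.rmax * P.rmax)) ≤ P.X ^ 5 := xb_mul a c
  have e : P.h * P.h * (P.h * P.h * (P.h * (P.rmax * P.rmax))) ≤ P.X ^ 7 := xb_mul a d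
  unfold gc
  exact xb_add hX (xb_le hX a (by norm_num)) e

/-- Auxiliary lemma `lc_le` (bounded-depth Frege toolkit / Pudlák–Krajíček construction, see the section header). [cite: Krajicek2019, proof of Thm. 11.4.7] -/
theorem lc_le : P.lc ≤ P.X ^ 3 := by
  unfold lc
  exact xb_mul (i := 1) (j := 2) (xb_one P.h_le_X) (xb_mul (xb_one P.h_le_X) (xb_one P.hXr))

/-- Auxiliary lemma `hr_le` (bounded-depth Frege toolkit / Pudlák–Krajíček construction, see the section header). [cite: Krajicek2019, proof of Thm. 11.4.7] -/
theorem hr_le : P.h * P.rmax ≤ P.X ^ 2 := xb_mul (xb_one P.h_le_X) (xb_one P.hXr)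

/-- Auxiliary lemma `hc_le` (bounded-depth Frege toolkit / Pudlák–Krajíček construction, see the section header). [cite: Krajicek2019, proof of Thm. 11.4.7] -/
theorem hc_le : P.h * P.cG ≤ P.X ^ 2 := xb_mul (xb_one P.h_le_X) (xb_one P.hXc)

end HB


end DepthFrege

end Literature.Computability.MetaComplexity
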